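import Mathlib.Analysis.Complex.HasPrimitives
import Mathlib.Analysis.Complex.LocallyUniformLimit
import Mathlib.Analysis.ODE.ExistUnique
import Mathlib.Analysis.Calculus.MeanValue
import Mathlib.Analysis.Calculus.ContDiff.RCLike
import Mathlib.Analysis.SpecificLimits.Basic
import HarnessLib

/-!
# Cauchy's existence and uniqueness theorem for a holomorphic first-order ODE (local theory)

Infrastructure for the proof of Painlevé's theorem `painleve_firstOrder_firstDegree`
(`Literature/Analysis/ODE/PainleveFirstOrder.lean`), following E. Hille, *Lectures on Ordinary
Differential Equations* (1969): the local existence theorem for `y' = F(z, y)` with `F`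
holomorphic in two complex variables (Hille, Thm. 2.5.1), in the form with a radius of
holomorphy UNIFORM in the initial point `(z*, y*)` near a point where `F` is holomorphic
(Hille, (12.1.2)–(12.1.3): the device behind "Case 1" and behind the exclusion of "Case 6" in
§12.1), and local uniqueness.

* `exists_solution_ball` — Picard's successive approximations on a disc: if `F` is holomorphic on
  `ball z₀ a × ball y₀ b`, bounded by `M` and `L`-Lipschitz in `y` there, then for every disc
  `ball z* ρ ⊆ ball z₀ a` with `‖y* - y₀‖ + M ρ < b` and `L ρ ≤ 1/2` there is a solution `y`
  holomorphic on `ball z* ρ` with `y z* = y*` (the iterates are holomorphic because a holomorphic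
  function on a disc has a primitive, `DifferentiableOn.isExactOn_ball`; the limit is holomorphic
  as a locally uniform limit).
* `exists_solution_nhds` — the uniform-radius corollary at a point where `F` is `C¹` over `ℂ`
  (e.g. analytic): radii `ρ, η > 0` such that every initial point in `ball z₀ η × ball y₀ η` has a
  solution holomorphic on `ball z* ρ` with values in a prescribed `ball y₀ ε`.
* `eventuallyEq_of_hasDerivAt` — local uniqueness: two solutions through the same point agree
  near it (Gronwall along rays, `ODE_solution_unique_of_mem_Icc_right`).

## References

* E. Hille, *Lectures on Ordinary Differential Equations*, Addison-Wesley 1969, §2.5 (Thm. 2.5.1)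
  and §12.1, (12.1.2)–(12.1.3). [cite: Hille1969, Thm. 2.5.1; §12.1 (12.1.3)]
* E. L. Ince, *Ordinary Differential Equations* (1926), §12.1–12.2.
-/

noncomputable section

namespace Literature.Analysis.ODE

open _root_.Complex Metric Set Filter
open scoped Topology NNReal

section Existence

variable {F : ℂ → ℂ → ℂ} {z₀ y₀ zs ys : ℂ} {a b M L ρ : ℝ}

/-- The integrand `s ↦ F(s, y(s))` of the Picard operator is holomorphic on the disc when `y` is
holomorphic there with values in the domain of `F`. [folklore] -/
theorem differentiableOn_comp_of_mapsTo {y : ℂ → ℂ} {U : Set ℂ}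
    (hF : DifferentiableOn ℂ (fun p : ℂ × ℂ => F p.1 p.2) (ball z₀ a ×ˢ ball y₀ b))
    (hU : U ⊆ ball z₀ a) (hy : DifferentiableOn ℂ y U) (hyb : MapsTo y U (ball y₀ b)) :
    DifferentiableOn ℂ (fun s => F s (y s)) U :=
  hF.comp (f := fun s => (s, y s)) (differentiableOn_id.prodMk hy) fun _ hs => ⟨hU hs, hyb hs⟩

/-- The Picard operator `T y (w) = y* + ∫_{z*}^{w} F(s, y(s)) ds` (wedge integral on the disc
`ball z* ρ`) has complex derivative `F(w, y(w))`. [cite: Hille1969, §2.5 (successive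
approximations)] -/
theorem hasDerivAt_picard {y : ℂ → ℂ}
    (hF : DifferentiableOn ℂ (fun p : ℂ × ℂ => F p.1 p.2) (ball z₀ a ×ˢ ball y₀ b))
    (hzs : ball zs ρ ⊆ ball z₀ a) (hy : DifferentiableOn ℂ y (ball zs ρ))
    (hyb : MapsTo y (ball zs ρ) (ball y₀ b)) {w : ℂ} (hw : w ∈ ball zs ρ) :
    HasDerivAt (fun w => ys + wedgeIntegral zs w (fun s => F s (y s))) (F w (y w)) w := by
  have hd : DifferentiableOn ℂ (fun s => F s (y s)) (ball zs ρ) :=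
    differentiableOn_comp_of_mapsTo hF hzs hy hyb
  exact (hd.isConservativeOn.hasDerivAt_wedgeIntegral hd.continuousOn hw).const_add ys

/-- The Picard operator fixes the initial value: `T y (z*) = y*`. [folklore] -/
theorem picard_apply_self (y : ℂ → ℂ) :
    ys + wedgeIntegral zs zs (fun s => F s (y s)) = ys := by
  simp [wedgeIntegral]

/-- Mean value inequality on a disc: a function with derivative bounded by `C` on `ball z* ρ`
satisfies `‖G w - G z*‖ ≤ C ‖w - z*‖`. [folklore] -/
theorem norm_sub_le_of_hasDerivAt_ball {G g : ℂ → ℂ} {C : ℝ} (hρ : 0 < ρ)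
    (hG : ∀ w ∈ ball zs ρ, HasDerivAt G (g w) w) (hC : ∀ w ∈ ball zs ρ, ‖g w‖ ≤ C)
    {w : ℂ} (hw : w ∈ ball zs ρ) : ‖G w - G zs‖ ≤ C * ‖w - zs‖ :=
  (convex_ball zs ρ).norm_image_sub_le_of_norm_hasDerivWithin_le
    (fun x hx => (hG x hx).hasDerivWithinAt) hC (mem_ball_self hρ) hw

/-- **Cauchy's existence theorem for `y' = F(z, y)`, `F` holomorphic, by successive
approximations on a disc.** If `F` is holomorphic on `ball z₀ a × ball y₀ b`, `‖F‖ ≤ M` and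
`F(z, ·)` is `L`-Lipschitz there (`M, L ≥ 0`), then for `ball z* ρ ⊆ ball z₀ a`,
`‖y* - y₀‖ + M ρ < b`, `L ρ ≤ 1/2`, there is `y` holomorphic on `ball z* ρ` with `y(z*) = y*`,
`y' = F(z, y)` and `‖y - y₀‖ ≤ ‖y* - y₀‖ + M ρ` on the disc. [cite: Hille1969, Thm. 2.5.1] -/
theorem exists_solution_ball
    (hF : DifferentiableOn ℂ (fun p : ℂ × ℂ => F p.1 p.2) (ball z₀ a ×ˢ ball y₀ b))
    (hM : ∀ z ∈ ball z₀ a, ∀ y ∈ ball y₀ b, ‖F z y‖ ≤ M) (hM0 : 0 ≤ M)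
    (hL : ∀ z ∈ ball z₀ a, ∀ y ∈ ball y₀ b, ∀ y' ∈ ball y₀ b, ‖F z y - F z y'‖ ≤ L * ‖y - y'‖)
    (hL0 : 0 ≤ L) (hρ : 0 < ρ) (hzs : ball zs ρ ⊆ ball z₀ a) (hys : ‖ys - y₀‖ + M * ρ < b)
    (hLρ : L * ρ ≤ 1 / 2) :
    ∃ y : ℂ → ℂ, DifferentiableOn ℂ y (ball zs ρ) ∧ y zs = ys ∧
      (∀ z ∈ ball zs ρ, ‖y z - y₀‖ ≤ ‖ys - y₀‖ + M * ρ) ∧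
      ∀ z ∈ ball zs ρ, HasDerivAt y (F z (y z)) z := by
  set T : (ℂ → ℂ) → ℂ → ℂ := fun y w => ys + wedgeIntegral zs w (fun s => F s (y s)) with hT
  set B : ℝ := ‖ys - y₀‖ + M * ρ with hB
  have hnorm_le : ∀ z ∈ ball zs ρ, ‖z - zs‖ ≤ ρ := fun z hz => by
    rw [mem_ball, dist_eq_norm] at hz
    exact hz.le
  -- admissible functions map the disc into `ball y₀ b`
  have hadm : ∀ y : ℂ → ℂ, (∀ z ∈ ball zs ρ, ‖y z - y₀‖ ≤ B) →
      MapsTo y (ball zs ρ) (ball y₀ b) := by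
    intro y hy z hz
    rw [mem_ball, dist_eq_norm]
    exact lt_of_le_of_lt (hy z hz) hys
  -- one Picard step
  have step : ∀ y : ℂ → ℂ, DifferentiableOn ℂ y (ball zs ρ) →
      (∀ z ∈ ball zs ρ, ‖y z - y₀‖ ≤ B) →
      (∀ z ∈ ball zs ρ, HasDerivAt (T y) (F z (y z)) z) ∧ DifferentiableOn ℂ (T y) (ball zs ρ) ∧
      T y zs = ys ∧ (∀ z ∈ ball zs ρ, ‖T y z - ys‖ ≤ M * ρ) ∧
      ∀ z ∈ ball zs ρ, ‖T y z - y₀‖ ≤ B := by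
    intro y hy hyB
    have hder : ∀ z ∈ ball zs ρ, HasDerivAt (T y) (F z (y z)) z := fun z hz =>
      hasDerivAt_picard hF hzs hy (hadm y hyB) hz
    have hzs' : T y zs = ys := picard_apply_self y
    have hbound : ∀ z ∈ ball zs ρ, ‖T y z - ys‖ ≤ M * ρ := by
      intro z hz
      have h1 : ‖T y z - T y zs‖ ≤ M * ‖z - zs‖ :=
        norm_sub_le_of_hasDerivAt_ball hρ hder
          (fun w hw => hM w (hzs hw) (y w) (hadm y hyB hw)) hz
      rw [hzs'] at h1
      calc ‖T y z - ys‖ ≤ M * ‖z - zs‖ := h1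
        _ ≤ M * ρ := by gcongr; exact hnorm_le z hz
    refine ⟨hder, fun z hz => (hder z hz).differentiableAt.differentiableWithinAt, hzs', hbound,
      fun z hz => ?_⟩
    calc ‖T y z - y₀‖ = ‖(T y z - ys) + (ys - y₀)‖ := by rw [sub_add_sub_cancel]
      _ ≤ ‖T y z - ys‖ + ‖ys - y₀‖ := norm_add_le _ _
      _ ≤ M * ρ + ‖ys - y₀‖ := by gcongr; exact hbound z hz
      _ = B := by rw [hB, add_comm]
  -- contraction
  have contr : ∀ y y' : ℂ → ℂ, DifferentiableOn ℂ y (ball zs ρ) →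
      (∀ z ∈ ball zs ρ, ‖y z - y₀‖ ≤ B) →
      DifferentiableOn ℂ y' (ball zs ρ) → (∀ z ∈ ball zs ρ, ‖y' z - y₀‖ ≤ B) →
      ∀ δ : ℝ, (∀ z ∈ ball zs ρ, ‖y z - y' z‖ ≤ δ) →
      ∀ z ∈ ball zs ρ, ‖T y z - T y' z‖ ≤ (1 / 2) * δ := by
    intro y y' hy hyB hy' hy'B δ hδ z hz
    have hδ0 : 0 ≤ δ := le_trans (norm_nonneg _) (hδ zs (mem_ball_self hρ))
    have hder : ∀ w ∈ ball zs ρ,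
        HasDerivAt (fun w => T y w - T y' w) (F w (y w) - F w (y' w)) w := fun w hw =>
      ((step y hy hyB).1 w hw).sub ((step y' hy' hy'B).1 w hw)
    have hC : ∀ w ∈ ball zs ρ, ‖F w (y w) - F w (y' w)‖ ≤ L * δ := fun w hw =>
      calc ‖F w (y w) - F w (y' w)‖ ≤ L * ‖y w - y' w‖ :=
            hL w (hzs hw) (y w) (hadm y hyB hw) (y' w) (hadm y' hy'B hw)
        _ ≤ L * δ := by gcongr; exact hδ w hw
    have h1 := norm_sub_le_of_hasDerivAt_ball (C := L * δ) hρ hder hC hz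
    rw [(step y hy hyB).2.2.1, (step y' hy' hy'B).2.2.1, sub_self, sub_zero] at h1
    calc ‖T y z - T y' z‖ ≤ L * δ * ‖z - zs‖ := h1
      _ = (L * ‖z - zs‖) * δ := by ring
      _ ≤ (L * ρ) * δ := by gcongr; exact hnorm_le z hz
      _ ≤ (1 / 2) * δ := by gcongr
  -- the iterates
  set Y : ℕ → ℂ → ℂ := fun n => T^[n] (fun _ => ys) with hY
  have hY_succ : ∀ n, Y (n + 1) = T (Y n) := fun n => Function.iterate_succ_apply' T n _
  have hYadm : ∀ n, DifferentiableOn ℂ (Y n) (ball zs ρ) ∧ (∀ z ∈ ball zs ρ, ‖Y n z - y₀‖ ≤ B) ∧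
      Y n zs = ys := by
    intro n
    induction n with
    | zero =>
      refine ⟨differentiableOn_const _, fun z _ => ?_, rfl⟩
      change ‖ys - y₀‖ ≤ B
      rw [hB]
      nlinarith [norm_nonneg (ys - y₀)]
    | succ n ih =>
      rw [hY_succ]
      exact ⟨(step _ ih.1 ih.2.1).2.1, (step _ ih.1 ih.2.1).2.2.2.2, (step _ ih.1 ih.2.1).2.2.1⟩
  -- geometric decay of the differences
  have hYdiff : ∀ n, ∀ z ∈ ball zs ρ, ‖Y (n + 1) z - Y n z‖ ≤ 2 * (M * ρ) / 2 / 2 ^ n := by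
    intro n
    induction n with
    | zero =>
      intro z hz
      rw [hY_succ, pow_zero, div_one, mul_div_cancel_left₀ _ (two_ne_zero' ℝ)]
      exact (step _ (hYadm 0).1 (hYadm 0).2.1).2.2.2.1 z hz
    | succ n ih =>
      intro z hz
      have h := contr (Y (n + 1)) (Y n) (hYadm (n + 1)).1 (hYadm (n + 1)).2.1 (hYadm n).1
        (hYadm n).2.1 _ ih z hz
      rw [← hY_succ, ← hY_succ] at h
      calc ‖Y (n + 1 + 1) z - Y (n + 1) z‖ ≤ 1 / 2 * (2 * (M * ρ) / 2 / 2 ^ n) := h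
        _ = 2 * (M * ρ) / 2 / 2 ^ (n + 1) := by rw [pow_succ]; ring
  have hYdist : ∀ z ∈ ball zs ρ, ∀ n,
      dist (Y n z) (Y (n + 1) z) ≤ 2 * (M * ρ) / 2 / 2 ^ n := by
    intro z hz n
    rw [dist_comm, dist_eq_norm]
    exact hYdiff n z hz
  -- the limit
  set y : ℂ → ℂ := fun z => limUnder atTop (fun n => Y n z) with hy
  have hlim : ∀ z ∈ ball zs ρ, Tendsto (fun n => Y n z) atTop (𝓝 (y z)) := fun z hz =>
    (cauchySeq_of_le_geometric_two (hYdist z hz)).tendsto_limUnder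
  have hrate : ∀ z ∈ ball zs ρ, ∀ n, dist (Y n z) (y z) ≤ 2 * (M * ρ) / 2 ^ n := fun z hz n =>
    dist_le_of_le_geometric_two_of_tendsto (hYdist z hz) (hlim z hz) n
  have hunif : TendstoUniformlyOn Y y atTop (ball zs ρ) := by
    rw [Metric.tendstoUniformlyOn_iff]
    intro ε hε
    have h0 : Tendsto (fun n : ℕ => 2 * (M * ρ) / 2 ^ n) atTop (𝓝 0) :=
      tendsto_const_nhds.div_atTop (tendsto_pow_atTop_atTop_of_one_lt one_lt_two)
    filter_upwards [(tendsto_order.1 h0).2 ε hε] with n hn z hz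
    rw [dist_comm]
    exact lt_of_le_of_lt (hrate z hz n) hn
  have hydiff : DifferentiableOn ℂ y (ball zs ρ) :=
    hunif.tendstoLocallyUniformlyOn.differentiableOn
      (Eventually.of_forall fun n => (hYadm n).1) isOpen_ball
  have hyB : ∀ z ∈ ball zs ρ, ‖y z - y₀‖ ≤ B := fun z hz =>
    le_of_tendsto (((hlim z hz).sub_const y₀).norm)
      (Eventually.of_forall fun n => (hYadm n).2.1 z hz)
  have hyzs : y zs = ys :=
    tendsto_nhds_unique (hlim zs (mem_ball_self hρ))
      (tendsto_const_nhds.congr fun n => ((hYadm n).2.2).symm)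
  -- `y` is a fixed point of `T`
  have hTy : ∀ z ∈ ball zs ρ, T y z = y z := by
    intro z hz
    refine tendsto_nhds_unique ?_ ((hlim z hz).comp (tendsto_add_atTop_nat 1))
    rw [tendsto_iff_norm_sub_tendsto_zero]
    have h0 : Tendsto (fun n : ℕ => (1 / 2) * (2 * (M * ρ) / 2 ^ n)) atTop (𝓝 0) := by
      have h := (tendsto_const_nhds.div_atTop (tendsto_pow_atTop_atTop_of_one_lt one_lt_two)
        (f := fun _ : ℕ => 2 * (M * ρ)) (l := atTop)).const_mul (1 / 2 : ℝ)
      rwa [mul_zero] at h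
    refine squeeze_zero (fun n => norm_nonneg _) (fun n => ?_) h0
    change ‖Y (n + 1) z - T y z‖ ≤ _
    rw [hY_succ]
    refine contr _ _ (hYadm n).1 (hYadm n).2.1 hydiff hyB _ (fun w hw => ?_) z hz
    rw [← dist_eq_norm]
    exact hrate w hw n
  refine ⟨y, hydiff, hyzs, hyB, fun z hz => ?_⟩
  have h1 : HasDerivAt (T y) (F z (y z)) z := (step y hydiff hyB).1 z hz
  refine h1.congr_of_eventuallyEq ?_
  filter_upwards [isOpen_ball.mem_nhds hz] with w hw using (hTy w hw).symm

/-- **Uniform radius of holomorphy near a regular point** (Hille (12.1.3)): if `F` is `C¹` over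
`ℂ` at `(z₀, y₀)` (e.g. holomorphic in the two variables), then for every `ε > 0` there are
`ρ ∈ (0, ε]` and `η > 0` such that for every initial point `(z*, y*)` with `‖z* - z₀‖ < η`,
`‖y* - y₀‖ < η` the equation `y' = F(z, y)` has a solution holomorphic on the whole disc
`ball z* ρ` with `y(z*) = y*` and values in `ball y₀ ε`. [cite: Hille1969, §12.1 (12.1.2)–(12.1.3)] -/
theorem exists_solution_nhds
    (hF : ContDiffAt ℂ 1 (fun p : ℂ × ℂ => F p.1 p.2) (z₀, y₀)) {ε : ℝ} (hε : 0 < ε) :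
    ∃ ρ > 0, ∃ η > 0, ρ ≤ ε ∧ ∀ zs ∈ ball z₀ η, ∀ ys ∈ ball y₀ η,
      ∃ y : ℂ → ℂ, DifferentiableOn ℂ y (ball zs ρ) ∧ y zs = ys ∧
        (∀ z ∈ ball zs ρ, y z ∈ ball y₀ ε) ∧ ∀ z ∈ ball zs ρ, HasDerivAt y (F z (y z)) z := by
  -- a neighbourhood of `(z₀, y₀)` where `F` is differentiable, bounded and Lipschitz
  obtain ⟨K, t, ht, hK⟩ := hF.exists_lipschitzOnWith
  have hdiff : ∀ᶠ p in 𝓝 (z₀, y₀), DifferentiableAt ℂ (fun p : ℂ × ℂ => F p.1 p.2) p := by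
    filter_upwards [hF.eventually (by simp)] with p hp using hp.differentiableAt one_ne_zero
  have hbdd : ∀ᶠ p in 𝓝 (z₀, y₀), ‖F p.1 p.2‖ < ‖F z₀ y₀‖ + 1 := by
    have hc : ContinuousAt (fun p : ℂ × ℂ => F p.1 p.2) (z₀, y₀) := hF.continuousAt
    have := hc.norm
    exact this.eventually (gt_mem_nhds (by linarith [norm_nonneg (F z₀ y₀)]))
  obtain ⟨a₀, ha₀, hball⟩ := Metric.mem_nhds_iff.mp (inter_mem ht (hdiff.and hbdd))
  set M : ℝ := ‖F z₀ y₀‖ + 1 with hM_def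
  set L : ℝ := (K : ℝ) with hL_def
  set a : ℝ := a₀ with ha_def
  set b : ℝ := min a₀ ε with hb_def
  have hb0 : 0 < b := lt_min ha₀ hε
  have hM0 : 0 ≤ M := by rw [hM_def]; positivity
  have hL0 : 0 ≤ L := K.2
  have hsub : ball z₀ a ×ˢ ball y₀ b ⊆ t ∩ {p | DifferentiableAt ℂ (fun p : ℂ × ℂ => F p.1 p.2) p ∧
      ‖F p.1 p.2‖ < ‖F z₀ y₀‖ + 1} := by
    intro p hp
    apply hball
    rw [← ball_prod_same]
    exact ⟨hp.1, ball_subset_ball (min_le_left _ _) hp.2⟩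
  have hFd : DifferentiableOn ℂ (fun p : ℂ × ℂ => F p.1 p.2) (ball z₀ a ×ˢ ball y₀ b) :=
    fun p hp => ((hsub hp).2.1).differentiableWithinAt
  have hFM : ∀ z ∈ ball z₀ a, ∀ y ∈ ball y₀ b, ‖F z y‖ ≤ M := fun z hz y hy =>
    ((hsub (mk_mem_prod hz hy)).2.2).le
  have hFL : ∀ z ∈ ball z₀ a, ∀ y ∈ ball y₀ b, ∀ y' ∈ ball y₀ b,
      ‖F z y - F z y'‖ ≤ L * ‖y - y'‖ := by
    intro z hz y hy y' hy'
    have h := hK.dist_le_mul (z, y) (hsub (mk_mem_prod hz hy)).1 (z, y') (hsub (mk_mem_prod hz hy')).1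
    rw [dist_eq_norm, dist_eq_norm] at h
    simpa [Prod.norm_def] using h
  -- the radii
  set ρ : ℝ := min (min (a / 2) ε) (min (b / (4 * (M + 1))) (1 / (2 * (L + 1)))) with hρ_def
  set η : ℝ := min (a / 2) (b / 2) with hη_def
  have hρ0 : 0 < ρ := by rw [hρ_def]; positivity
  have hη0 : 0 < η := by rw [hη_def]; positivity
  refine ⟨ρ, hρ0, η, hη0, (min_le_left _ _).trans (min_le_right _ _), fun zs hzs ys hys => ?_⟩
  have hρa : ρ ≤ a / 2 := (min_le_left _ _).trans (min_le_left _ _)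
  have hρb : M * ρ ≤ b / 4 := by
    have h1 : ρ ≤ b / (4 * (M + 1)) := (min_le_right _ _).trans (min_le_left _ _)
    calc M * ρ ≤ M * (b / (4 * (M + 1))) := by gcongr
      _ = (M / (M + 1)) * (b / 4) := by field_simp
      _ ≤ 1 * (b / 4) := by
        gcongr
        rw [div_le_one (by positivity)]
        linarith
      _ = b / 4 := one_mul _
  have hρL : L * ρ ≤ 1 / 2 := by
    have h1 : ρ ≤ 1 / (2 * (L + 1)) := (min_le_right _ _).trans (min_le_right _ _)
    calc L * ρ ≤ L * (1 / (2 * (L + 1))) := by gcongr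
      _ = (L / (L + 1)) * (1 / 2) := by field_simp
      _ ≤ 1 * (1 / 2) := by
        gcongr
        rw [div_le_one (by positivity)]
        linarith
      _ = 1 / 2 := one_mul _
  have hzsub : ball zs ρ ⊆ ball z₀ a := by
    intro z hz
    rw [mem_ball] at hz hzs ⊢
    have hη : η ≤ a / 2 := min_le_left _ _
    calc dist z z₀ ≤ dist z zs + dist zs z₀ := dist_triangle _ _ _
      _ < ρ + η := add_lt_add hz hzs
      _ ≤ a / 2 + a / 2 := add_le_add hρa hη
      _ = a := by ring
  have hysb : ‖ys - y₀‖ + M * ρ < b := by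
    rw [mem_ball, dist_eq_norm] at hys
    have hη : η ≤ b / 2 := min_le_right _ _
    linarith
  obtain ⟨y, hyd, hy0, hyB, hyder⟩ :=
    exists_solution_ball hFd hFM hM0 hFL hL0 hρ0 hzsub hysb hρL
  refine ⟨y, hyd, hy0, fun z hz => ?_, hyder⟩
  rw [mem_ball, dist_eq_norm]
  exact lt_of_le_of_lt (hyB z hz) (lt_of_lt_of_le hysb (min_le_right _ _))

end Existence

section Uniqueness

variable {F : ℂ → ℂ → ℂ} {z₀ w₀ zs : ℂ} {a b L : ℝ}

/-- A solution of `y' = F(z, y)` restricted to a real segment `t ↦ z* + t d` is a solution of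
the real-time ODE `u̇ = d F(z* + t d, u)`. [folklore] -/
theorem hasDerivAt_comp_line {y : ℂ → ℂ} {d : ℂ} {t : ℝ}
    (hy : HasDerivAt y (F (zs + t * d) (y (zs + t * d))) (zs + t * d)) :
    HasDerivAt (fun s : ℝ => y (zs + s * d)) (d * F (zs + t * d) (y (zs + t * d))) t := by
  have hinner : HasDerivAt (fun w : ℂ => zs + w * d) d (t : ℂ) := by
    simpa using ((hasDerivAt_id (t : ℂ)).mul_const d).const_add zs
  have h := HasDerivAt.comp (t : ℂ) hy hinner
  rw [mul_comm] at h
  exact h.comp_ofReal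

/-- **Local uniqueness** for `y' = F(z, y)` with `F(z, ·)` Lipschitz near `(z*, y₁ z*)`: two
solutions near `z*` with the same value at `z*` agree on a neighbourhood of `z*` (Gronwall's
inequality along the segments `z* + t d`, `t ∈ [0, 1]`). [cite: Hille1969, Thm. 2.5.1
(uniqueness)] -/
theorem eventuallyEq_of_hasDerivAt {y₁ y₂ : ℂ → ℂ}
    (hL : ∀ z ∈ ball z₀ a, ∀ y ∈ ball w₀ b, ∀ y' ∈ ball w₀ b, ‖F z y - F z y'‖ ≤ L * ‖y - y'‖)
    (hzs : zs ∈ ball z₀ a) (hw : y₁ zs ∈ ball w₀ b)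
    (h₁ : ∀ᶠ z in 𝓝 zs, HasDerivAt y₁ (F z (y₁ z)) z)
    (h₂ : ∀ᶠ z in 𝓝 zs, HasDerivAt y₂ (F z (y₂ z)) z) (heq : y₁ zs = y₂ zs) :
    y₁ =ᶠ[𝓝 zs] y₂ := by
  have hc₁ : ContinuousAt y₁ zs := h₁.self_of_nhds.continuousAt
  have hc₂ : ContinuousAt y₂ zs := h₂.self_of_nhds.continuousAt
  have hw₂ : y₂ zs ∈ ball w₀ b := heq ▸ hw
  have hall : ∀ᶠ z in 𝓝 zs, z ∈ ball z₀ a ∧ (HasDerivAt y₁ (F z (y₁ z)) z ∧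
      HasDerivAt y₂ (F z (y₂ z)) z) ∧ (y₁ z ∈ ball w₀ b ∧ y₂ z ∈ ball w₀ b) :=
    (isOpen_ball.eventually_mem hzs).and ((h₁.and h₂).and
      ((hc₁.eventually_mem (isOpen_ball.mem_nhds hw)).and
        (hc₂.eventually_mem (isOpen_ball.mem_nhds hw₂))))
  obtain ⟨δ, hδ, hballδ⟩ := Metric.eventually_nhds_iff_ball.mp hall
  rw [Filter.eventuallyEq_iff_exists_mem]
  refine ⟨ball zs δ, ball_mem_nhds _ hδ, fun z hz => ?_⟩
  -- the segment from `zs` to `z`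
  set d : ℂ := z - zs with hd
  have hdδ : ‖d‖ < δ := by rwa [hd, ← dist_eq_norm]
  have hseg : ∀ s ∈ Icc (0 : ℝ) 1, zs + s * d ∈ ball zs δ := by
    intro s hs
    rw [mem_ball, dist_eq_norm, add_sub_cancel_left, norm_mul, Complex.norm_real, Real.norm_eq_abs,
      abs_of_nonneg hs.1]
    calc s * ‖d‖ ≤ 1 * ‖d‖ := by gcongr; exact hs.2
      _ = ‖d‖ := one_mul _
      _ < δ := hdδ
  set f : ℝ → ℂ := fun s => y₁ (zs + s * d) with hf
  set g : ℝ → ℂ := fun s => y₂ (zs + s * d) with hg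
  set v : ℝ → ℂ → ℂ := fun s x => d * F (zs + s * d) x with hv
  have hfd : ∀ s ∈ Icc (0 : ℝ) 1, HasDerivAt f (v s (f s)) s := fun s hs =>
    hasDerivAt_comp_line (hballδ _ (hseg s hs)).2.1.1
  have hgd : ∀ s ∈ Icc (0 : ℝ) 1, HasDerivAt g (v s (g s)) s := fun s hs =>
    hasDerivAt_comp_line (hballδ _ (hseg s hs)).2.1.2
  have hlip : ∀ s ∈ Ico (0 : ℝ) 1, LipschitzOnWith (Real.toNNReal (‖d‖ * L)) (v s) (ball w₀ b) := by
    intro s hs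
    refine LipschitzOnWith.of_dist_le' fun x hx x' hx' => ?_
    rw [dist_eq_norm, dist_eq_norm, hv]
    dsimp only
    rw [← mul_sub, norm_mul, mul_assoc]
    gcongr
    exact hL _ (hballδ _ (hseg s (Ico_subset_Icc_self hs))).1 x hx x' hx'
  have huniq := ODE_solution_unique_of_mem_Icc_right (v := v) (s := fun _ => ball w₀ b)
    (f := f) (g := g) (a := 0) (b := 1) hlip
    (fun s hs => (hfd s hs).continuousAt.continuousWithinAt)
    (fun s hs => (hfd s (Ico_subset_Icc_self hs)).hasDerivWithinAt)
    (fun s hs => (hballδ _ (hseg s (Ico_subset_Icc_self hs))).2.2.1)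
    (fun s hs => (hgd s hs).continuousAt.continuousWithinAt)
    (fun s hs => (hgd s (Ico_subset_Icc_self hs)).hasDerivWithinAt)
    (fun s hs => (hballδ _ (hseg s (Ico_subset_Icc_self hs))).2.2.2)
    (by simp [hf, hg, heq])
  have h1 := huniq (right_mem_Icc.mpr zero_le_one)
  simp only [hf, hg, Complex.ofReal_one, one_mul, hd, add_sub_cancel] at h1
  exact h1

end Uniqueness

end Literature.Analysis.ODE
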